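import Summits.BirchSwinnertonDyer.BirchSwinnertonDyer.Theses.ShaPrimaryTransfer

/-!
# BirchSwinnertonDyer / ShaPrimaryTransfer — the assembly item (stmt-BirchSwinnertonDyer-22358)

Route `ShaPrimaryTransfer` (route-BirchSwinnertonDyer-ShaPrimaryTransfer, D-0145 LINE 2). Its assembly item
`Assembly := FiniteShaComponentTransfer → OneFiniteShaComponent → AnalyticRankLeSelmerCorank →
PadicOrderLeAnalyticRankAtOnePrime → KatoRankBound → BirchSwinnertonDyer` is, verbatim, the type of the
route's planner-authored deciding theorem `Theses.ShaPrimaryTransfer.closes` (sorry-free in the route module: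
kernel `O ⟹ p₀`, `T ⟹ every q`; then KatoTransfer's two legs on a global minimal model at the X3 prime), so
the item closes by that theorem. This file proves NOTHING about the five hypotheses — T
(`FiniteShaComponentTransfer`, stmt-22356), O (`OneFiniteShaComponent`, stmt-22357), X2, X3 and the Kato
side remain open items (T and O conjecture-grade at analytic rank ≥ 2; see
`ShaPrimaryTransferFiniteShaComponentTransferSlices` / `…Sectors` for what is proved about T) — and BSD is
NOT proved by it.
-/

-- D-0017: single-problem summit, so `Summit.BirchSwinnertonDyer.BirchSwinnertonDyer.…` repeats a namespace BY DESIGN.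
set_option linter.dupNamespace false

namespace Summit.BirchSwinnertonDyer.BirchSwinnertonDyer.Theorems

/-- **The assembly of route `ShaPrimaryTransfer`** (stmt-BirchSwinnertonDyer-22358): the five items imply
the summit statement — by the route's deciding theorem `Theses.ShaPrimaryTransfer.closes` (kernel: the door
prime of O transferred by T gives `corank Ш(E)[q^∞] = 0` at every `q`; legs: Kummer identity
`corank Sel_{p^∞} = rank + corank Ш[p^∞]` (Greenberg LNM 1716 §1, tree theorem) with X2 for
`r_an ≤ r_MW`, X3 with Kato's bound for `r_MW ≤ r_an`, on a global minimal model; ranks transported along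
the isomorphism). [cite: Greenberg1999LNM, §1 pp. 54–57] [cite: Kato2004Asterisque, Thm. 17.4] -/
theorem shaPrimaryTransfer_assembly_proof :
    Summit.BirchSwinnertonDyer.BirchSwinnertonDyer.Theses.ShaPrimaryTransfer.Assembly :=
  fun hT hO hX2 hX3 hK =>
    Summit.BirchSwinnertonDyer.BirchSwinnertonDyer.Theses.ShaPrimaryTransfer.closes hT hO hX2 hX3 hK

end Summit.BirchSwinnertonDyer.BirchSwinnertonDyer.Theorems
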